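import Summits.Ventures.Crystal3D.Theorems.StickyWulffConstantGenericWallFloorSharedTriangle
import Summits.Ventures.Crystal3D.Theorems.StickyWulffConstantGenericWallFloorCoaxialCriterion
import Summits.Ventures.Crystal3D.Theorems.StickyWulffConstantCoaxialWallLawTerracePropagation
import Summits.Ventures.Crystal3D.Theorems.StickyWulffConstantGenericWallFloorStepGain
import Mathlib.Algebra.Order.BigOperators.GroupWithZero.Finset
import HarnessLib

/-!
# The terminal class of the top grain and its tilt modulus (chain pairs)

HONEST FRAMING. Venture `Summits/Ventures/Crystal3D` (cell `crystal3d-full`), helper for the crux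
`GenericWallFloor` (stmt-Ventures-19480) of `route-Ventures-StickyWulffConstant`, REGISTERED line `WallLedgerG`,
open stub `stub_twoSlabAdhesion` (general fillings; the `Σ3ⁿ` chain pairs).  Rung credit only; F-C1 not moved.

`exists_terminalClass`: for every NON-CO-AXIAL pair `(A₁·Λ₀ + t₁, A₂·Λ₀ + t₂)` (the crux's hypothesis verbatim)
there are a set `𝓣` of frames and a TILT MODULUS `0 < δ₀ ≤ 1` with the four properties consumed by
`card_chainPayers_ge_sf` (…TubeCountChain): `A₁ ∉ 𝓣`; every `G` with `G(Λ₀) = A₂(Λ₀)` is in `𝓣`; `𝓣` is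
closed under the horizontal menu mirrors; every non-horizontal unit menu normal `n` of a frame of `𝓣` has
`δ₀ ≤ (√3/2)√(1 − ⟪n, e₃⟫²)`.  The class is «`G(Λ₀) = A₂(Λ₀)`, or `e₃` is a menu normal of `A₂` and
`G(Λ₀)` is the horizontal mirror image of `A₂(Λ₀)`»: `A₁` is outside it because equal lattices are co-axial
(`coaxial_of_image_eq`) and a lattice and its horizontal twin share the in-plane hexagon
(`coaxial_of_shared_adjacent_slots`); the modulus exists because a menu normal is `(G u₁ + G u₂ + G u₃)/√6` for
three far slots (`sum_eq_sqrt_six_smul`), so `⟪n, e₃⟫²` ranges over the finite set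
`{(⟪A₂w₁, e₃⟫ + ⟪A₂w₂, e₃⟫ + ⟪A₂w₃, e₃⟫)²/6 : wᵢ slots}`.
WHAT THIS IS NOT: not the stub; F-C1 not moved.
-/

noncomputable section

namespace Summit.Ventures.Crystal3D.Theorems

open Summit.Ventures.Crystal3D Finset
open Literature.MathematicalPhysics.StatisticalMechanics (fccStacking IsHaggSeq barlowStacking)
open scoped InnerProductSpace

/-- The horizontal mirror `x ↦ x − 2⟪x, e₃⟫ e₃` flips the height. -/
theorem inner_horizMirror_e₃ (x : EuclideanSpace ℝ (Fin 3)) :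
    ⟪x - (2 * ⟪x, EuclideanSpace.single (2 : Fin 3) (1 : ℝ)⟫_ℝ) • EuclideanSpace.single (2 : Fin 3) (1 : ℝ),
      EuclideanSpace.single (2 : Fin 3) (1 : ℝ)⟫_ℝ = -⟪x, EuclideanSpace.single (2 : Fin 3) (1 : ℝ)⟫_ℝ := by
  have he : ‖EuclideanSpace.single (2 : Fin 3) (1 : ℝ)‖ = 1 := by rw [PiLp.norm_single, norm_one]
  rw [inner_sub_left, real_inner_smul_left, real_inner_self_eq_norm_sq, he]; ring

/-- The horizontal mirror is an involution. -/
theorem horizMirror_horizMirror (x : EuclideanSpace ℝ (Fin 3)) :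
    (x - (2 * ⟪x, EuclideanSpace.single (2 : Fin 3) (1 : ℝ)⟫_ℝ) • EuclideanSpace.single (2 : Fin 3) (1 : ℝ)) -
      (2 * ⟪x - (2 * ⟪x, EuclideanSpace.single (2 : Fin 3) (1 : ℝ)⟫_ℝ) • EuclideanSpace.single (2 : Fin 3) (1 : ℝ),
        EuclideanSpace.single (2 : Fin 3) (1 : ℝ)⟫_ℝ) • EuclideanSpace.single (2 : Fin 3) (1 : ℝ) = x := by
  rw [inner_horizMirror_e₃, mul_neg, neg_smul, sub_neg_eq_add, sub_add_cancel]

/-- The horizontal mirror preserves norms. -/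
theorem norm_horizMirror (x : EuclideanSpace ℝ (Fin 3)) :
    ‖x - (2 * ⟪x, EuclideanSpace.single (2 : Fin 3) (1 : ℝ)⟫_ℝ) • EuclideanSpace.single (2 : Fin 3) (1 : ℝ)‖ = ‖x‖ := by
  have he : ‖EuclideanSpace.single (2 : Fin 3) (1 : ℝ)‖ = 1 := by rw [PiLp.norm_single, norm_one]
  have h : ‖x - (2 * ⟪x, EuclideanSpace.single (2 : Fin 3) (1 : ℝ)⟫_ℝ) • EuclideanSpace.single (2 : Fin 3) (1 : ℝ)‖ ^ 2 =
      ‖x‖ ^ 2 := by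
    rw [norm_sub_sq_real, norm_smul, he, mul_one, real_inner_smul_right, Real.norm_eq_abs, sq_abs]; ring
  nlinarith [norm_nonneg (x - (2 * ⟪x, EuclideanSpace.single (2 : Fin 3) (1 : ℝ)⟫_ℝ) • EuclideanSpace.single (2 : Fin 3) (1 : ℝ)),
    norm_nonneg x]

/-- The menu property only depends on the linear lattice. -/
theorem menu_of_image_eq (G A : EuclideanSpace ℝ (Fin 3) ≃ₗᵢ[ℝ] EuclideanSpace ℝ (Fin 3))
    (h : G '' fccStacking 1 (Real.sqrt (2 / 3)) = A '' fccStacking 1 (Real.sqrt (2 / 3)))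
    {n : EuclideanSpace ℝ (Fin 3)}
    (hmenu : ∀ w ∈ fccSlots, ⟪G w, n⟫_ℝ = 0 ∨ ⟪G w, n⟫_ℝ = Real.sqrt (2 / 3) ∨ ⟪G w, n⟫_ℝ = -Real.sqrt (2 / 3)) :
    ∀ w ∈ fccSlots, ⟪A w, n⟫_ℝ = 0 ∨ ⟪A w, n⟫_ℝ = Real.sqrt (2 / 3) ∨ ⟪A w, n⟫_ℝ = -Real.sqrt (2 / 3) := by
  intro w hw
  have hAw : A w ∈ G '' fccStacking 1 (Real.sqrt (2 / 3)) := by rw [h]; exact ⟨w, mem_fcc_of_mem_fccSlots hw, rfl⟩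
  obtain ⟨y, hy, hyw⟩ := hAw
  have hy1 : ‖y‖ = 1 := by
    have := congrArg norm hyw
    rw [LinearIsometryEquiv.norm_map, LinearIsometryEquiv.norm_map, norm_eq_one_of_mem_fccSlots hw] at this
    exact this
  rw [← hyw]
  exact hmenu y (mem_fccSlots_of_unit hy hy1)

/-- A unit vector of a moved lattice is the image of a slot. -/
theorem exists_slot_of_unit_mem (G : EuclideanSpace ℝ (Fin 3) ≃ₗᵢ[ℝ] EuclideanSpace ℝ (Fin 3))
    {v : EuclideanSpace ℝ (Fin 3)} (hv : v ∈ G '' fccStacking 1 (Real.sqrt (2 / 3))) (hv1 : ‖v‖ = 1) :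
    ∃ w ∈ fccSlots, G w = v := by
  obtain ⟨y, hy, rfl⟩ := hv
  rw [LinearIsometryEquiv.norm_map] at hv1
  exact ⟨y, mem_fccSlots_of_unit hy hv1, rfl⟩

open scoped Classical in
/-- **The terminal class and its tilt modulus.**  See the module docstring. -/
theorem exists_terminalClass
    (A₁ : EuclideanSpace ℝ (Fin 3) ≃ₗᵢ[ℝ] EuclideanSpace ℝ (Fin 3)) (t₁ : EuclideanSpace ℝ (Fin 3))
    (A₂ : EuclideanSpace ℝ (Fin 3) ≃ₗᵢ[ℝ] EuclideanSpace ℝ (Fin 3)) (t₂ : EuclideanSpace ℝ (Fin 3))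
    (hnc : ¬ ∃ (L : EuclideanSpace ℝ (Fin 3) ≃ₗᵢ[ℝ] EuclideanSpace ℝ (Fin 3))
        (s₁ s₂ : EuclideanSpace ℝ (Fin 3)) (σ σ' : ℤ → ℤ), IsHaggSeq σ ∧ IsHaggSeq σ' ∧
        (fun p => A₁ p + t₁) '' fccStacking 1 (Real.sqrt (2 / 3)) ⊆
          (fun p => L p + s₁) '' barlowStacking 1 (Real.sqrt (2 / 3)) σ ∧
        (fun p => A₂ p + t₂) '' fccStacking 1 (Real.sqrt (2 / 3)) ⊆
          (fun p => L p + s₂) '' barlowStacking 1 (Real.sqrt (2 / 3)) σ') :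
    ∃ (𝓣 : Set (EuclideanSpace ℝ (Fin 3) ≃ₗᵢ[ℝ] EuclideanSpace ℝ (Fin 3))) (δ₀ : ℝ), 0 < δ₀ ∧ δ₀ ≤ 1 ∧
      A₁ ∉ 𝓣 ∧
      (∀ G : EuclideanSpace ℝ (Fin 3) ≃ₗᵢ[ℝ] EuclideanSpace ℝ (Fin 3),
        G '' fccStacking 1 (Real.sqrt (2 / 3)) = A₂ '' fccStacking 1 (Real.sqrt (2 / 3)) → G ∈ 𝓣) ∧
      (∀ G ∈ 𝓣, ∀ n : EuclideanSpace ℝ (Fin 3), ‖n‖ = 1 →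
        ⟪n, EuclideanSpace.single (2 : Fin 3) (1 : ℝ)⟫_ℝ ^ 2 = 1 →
        (∀ w ∈ fccSlots, ⟪G w, n⟫_ℝ = 0 ∨ ⟪G w, n⟫_ℝ = Real.sqrt (2 / 3) ∨ ⟪G w, n⟫_ℝ = -Real.sqrt (2 / 3)) →
        ∀ G' : EuclideanSpace ℝ (Fin 3) ≃ₗᵢ[ℝ] EuclideanSpace ℝ (Fin 3),
          (∀ x, G' x = G x - (2 * ⟪G x, n⟫_ℝ) • n) → G' ∈ 𝓣) ∧
      (∀ G ∈ 𝓣, ∀ n : EuclideanSpace ℝ (Fin 3), ‖n‖ = 1 →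
        (∀ w ∈ fccSlots, ⟪G w, n⟫_ℝ = 0 ∨ ⟪G w, n⟫_ℝ = Real.sqrt (2 / 3) ∨ ⟪G w, n⟫_ℝ = -Real.sqrt (2 / 3)) →
        ⟪n, EuclideanSpace.single (2 : Fin 3) (1 : ℝ)⟫_ℝ ^ 2 < 1 →
        δ₀ ≤ Real.sqrt 3 / 2 * Real.sqrt (1 - ⟪n, EuclideanSpace.single (2 : Fin 3) (1 : ℝ)⟫_ℝ ^ 2)) := by
  set e₃ : EuclideanSpace ℝ (Fin 3) := EuclideanSpace.single (2 : Fin 3) (1 : ℝ) with he₃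
  have he₃n : ‖e₃‖ = 1 := by rw [he₃, PiLp.norm_single, norm_one]
  set H : EuclideanSpace ℝ (Fin 3) → EuclideanSpace ℝ (Fin 3) := fun x => x - (2 * ⟪x, e₃⟫_ℝ) • e₃ with hH
  have hHH : ∀ x, H (H x) = x := fun x => horizMirror_horizMirror x
  have hHn : ∀ x, ‖H x‖ = ‖x‖ := fun x => norm_horizMirror x
  have hHe : ∀ x, ⟪H x, e₃⟫_ℝ = -⟪x, e₃⟫_ℝ := fun x => inner_horizMirror_e₃ x
  have hHimg : ∀ S : Set (EuclideanSpace ℝ (Fin 3)), H '' (H '' S) = S := by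
    intro S; rw [Set.image_image]; conv_rhs => rw [← Set.image_id S]
    exact Set.image_congr fun x _ => hHH x
  set Λ₂ : Set (EuclideanSpace ℝ (Fin 3)) := A₂ '' fccStacking 1 (Real.sqrt (2 / 3)) with hΛ₂
  set menu₂ : Prop := ∀ w ∈ fccSlots, ⟪A₂ w, e₃⟫_ℝ = 0 ∨ ⟪A₂ w, e₃⟫_ℝ = Real.sqrt (2 / 3) ∨
    ⟪A₂ w, e₃⟫_ℝ = -Real.sqrt (2 / 3) with hmenu₂
  set 𝓣 : Set (EuclideanSpace ℝ (Fin 3) ≃ₗᵢ[ℝ] EuclideanSpace ℝ (Fin 3)) :=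
    {G | G '' fccStacking 1 (Real.sqrt (2 / 3)) = Λ₂ ∨ (menu₂ ∧ G '' fccStacking 1 (Real.sqrt (2 / 3)) = H '' Λ₂)}
    with h𝓣
  -- the finite set of height-squares of menu normals, and the modulus
  set VALS : Finset ℝ := ((fccSlots ×ˢ fccSlots) ×ˢ fccSlots).image fun w =>
    (⟪A₂ w.1.1, e₃⟫_ℝ + ⟪A₂ w.1.2, e₃⟫_ℝ + ⟪A₂ w.2, e₃⟫_ℝ) ^ 2 / 6 with hVALS
  set BAD : Finset ℝ := VALS.filter fun t => t < 1 with hBAD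
  set fac : ℝ → ℝ := fun t => min 1 (Real.sqrt 3 / 2 * Real.sqrt (1 - t)) with hfac
  set δ₀ : ℝ := ∏ t ∈ BAD, fac t with hδ₀
  have hfac_pos : ∀ t ∈ BAD, 0 < fac t := by
    intro t ht
    rw [hBAD, mem_filter] at ht
    have : 0 < Real.sqrt (1 - t) := Real.sqrt_pos.2 (by linarith [ht.2])
    exact lt_min one_pos (by positivity)
  have hfac_le : ∀ t ∈ BAD, fac t ≤ 1 := fun t _ => min_le_left _ _
  have hδ₀pos : 0 < δ₀ := Finset.prod_pos hfac_pos
  have hδ₀le : δ₀ ≤ 1 := Finset.prod_le_one (fun t ht => (hfac_pos t ht).le) hfac_le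
  have hδ₀fac : ∀ t ∈ BAD, δ₀ ≤ Real.sqrt 3 / 2 * Real.sqrt (1 - t) := by
    intro t ht
    have h1 : δ₀ = fac t * ∏ s ∈ BAD.erase t, fac s := (Finset.mul_prod_erase BAD fac ht).symm
    have h2 : ∏ s ∈ BAD.erase t, fac s ≤ 1 :=
      Finset.prod_le_one (fun s hs => (hfac_pos s (mem_of_mem_erase hs)).le)
        (fun s hs => hfac_le s (mem_of_mem_erase hs))
    have h3 : δ₀ ≤ fac t := by
      rw [h1]; exact mul_le_of_le_one_right (hfac_pos t ht).le h2
    exact h3.trans (min_le_right _ _)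
  refine ⟨𝓣, δ₀, hδ₀pos, hδ₀le, ?_, fun G hG => Or.inl hG, ?_, ?_⟩
  · -- `A₁ ∉ 𝓣`: both alternatives make the pair co-axial
    rintro (hEq | ⟨hm₂, hEq⟩)
    · exact hnc (coaxial_of_image_eq A₁ A₂ t₁ t₂ hEq)
    · -- the in-plane hexagon of `A₂` is fixed by `H`
      obtain ⟨u₁, hu₁, u₂, hu₂, u₃, hu₃, hn₁, hn₂, hn₃, i12, i13, i23, -, -⟩ := exists_far_frame A₂ he₃n hm₂
      have hs12 : u₁ - u₂ ∈ fccSlots := sub_mem_fccSlots_of_inner_eq_half hu₁ hu₂ i12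
      have hs13 : u₁ - u₃ ∈ fccSlots := sub_mem_fccSlots_of_inner_eq_half hu₁ hu₃ i13
      have hu1 : ⟪u₁, u₁⟫_ℝ = 1 := by rw [real_inner_self_eq_norm_sq, norm_eq_one_of_mem_fccSlots hu₁, one_pow]
      have hab : ⟪A₂ (u₁ - u₂), A₂ (u₁ - u₃)⟫_ℝ = 1 / 2 := by
        rw [LinearIsometryEquiv.inner_map_map, inner_sub_left, inner_sub_right, inner_sub_right, hu1, i13,
          real_inner_comm u₁ u₂, i12, i23]; norm_num
      have hfix : ∀ {w}, w ∈ fccSlots → ⟪A₂ w, e₃⟫_ℝ = 0 → A₂ w ∈ H '' Λ₂ := by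
        intro w hw h0
        refine ⟨A₂ w, ⟨w, mem_fcc_of_mem_fccSlots hw, rfl⟩, ?_⟩
        show A₂ w - (2 * ⟪A₂ w, e₃⟫_ℝ) • e₃ = A₂ w
        rw [h0, mul_zero, zero_smul, sub_zero]
      have h12e : ⟪A₂ (u₁ - u₂), e₃⟫_ℝ = 0 := by rw [map_sub, inner_sub_left, hn₁, hn₂, sub_self]
      have h13e : ⟪A₂ (u₁ - u₃), e₃⟫_ℝ = 0 := by rw [map_sub, inner_sub_left, hn₁, hn₃, sub_self]
      refine hnc (coaxial_of_shared_adjacent_slots A₁ A₂ t₁ t₂ (A₂ (u₁ - u₂)) (A₂ (u₁ - u₃)) ?_ ?_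
        ⟨u₁ - u₂, mem_fcc_of_mem_fccSlots hs12, rfl⟩ ⟨u₁ - u₃, mem_fcc_of_mem_fccSlots hs13, rfl⟩
        (by rw [LinearIsometryEquiv.norm_map, norm_eq_one_of_mem_fccSlots hs12])
        (by rw [LinearIsometryEquiv.norm_map, norm_eq_one_of_mem_fccSlots hs13]) hab)
      · rw [hEq]; exact hfix hs12 h12e
      · rw [hEq]; exact hfix hs13 h13e
  · -- closure under horizontal menu mirrors
    intro G hG n hn hn2 hmenu G' hG'
    -- `n = c • e₃` with `c = ⟪n, e₃⟫`, `c² = 1`, so `G' = H ∘ G`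
    set c : ℝ := ⟪n, e₃⟫_ℝ with hc
    have hnc' : n = c • e₃ := by
      have h0 : ‖n - c • e₃‖ ^ 2 = 0 := by
        rw [norm_sub_sq_real, hn, norm_smul, he₃n, mul_one, real_inner_smul_right, ← hc, Real.norm_eq_abs,
          sq_abs, one_pow]
        nlinarith
      exact sub_eq_zero.1 (norm_eq_zero.1 (pow_eq_zero_iff two_ne_zero |>.1 h0))
    have hG'H : ∀ x, G' x = H (G x) := by
      intro x
      rw [hG' x, hnc', real_inner_smul_right, smul_smul]
      show G x - (2 * (c * ⟪G x, e₃⟫_ℝ) * c) • e₃ = G x - (2 * ⟪G x, e₃⟫_ℝ) • e₃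
      congr 2
      have : c * c = 1 := by nlinarith
      linear_combination 2 * ⟪G x, e₃⟫_ℝ * this
    have hG'img : G' '' fccStacking 1 (Real.sqrt (2 / 3)) = H '' (G '' fccStacking 1 (Real.sqrt (2 / 3))) := by
      rw [Set.image_image]; exact Set.image_congr fun x _ => hG'H x
    have hmenuG : ∀ w ∈ fccSlots, ⟪G w, e₃⟫_ℝ = 0 ∨ ⟪G w, e₃⟫_ℝ = Real.sqrt (2 / 3) ∨ ⟪G w, e₃⟫_ℝ = -Real.sqrt (2 / 3) := by
      intro w hw
      have hc1 : c = 1 ∨ c = -1 := by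
        have : (c - 1) * (c + 1) = 0 := by nlinarith
        rcases mul_eq_zero.1 this with h | h
        · left; linarith
        · right; linarith
      have e1 : ⟪G w, n⟫_ℝ = c * ⟪G w, e₃⟫_ℝ := by rw [hnc', real_inner_smul_right]
      rcases hmenu w hw with h | h | h <;> rw [e1] at h <;> rcases hc1 with h1 | h1 <;> rw [h1] at h
      · left; linarith
      · left; linarith
      · right; left; linarith
      · right; right; linarith
      · right; right; linarith
      · right; left; linarith
    rcases hG with hEq | ⟨hm₂, hEq⟩
    · right
      refine ⟨menu_of_image_eq G A₂ hEq hmenuG, ?_⟩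
      rw [hG'img, hEq]
    · left
      rw [hG'img, hEq, hHimg]
  · -- the tilt modulus
    intro G hG n hn hmenu hn2
    have hrpos : 0 < Real.sqrt (2 / 3) := Real.sqrt_pos.2 (by norm_num)
    have h6pos : 0 < Real.sqrt 6 := Real.sqrt_pos.2 (by norm_num)
    obtain ⟨u₁, hu₁, u₂, hu₂, u₃, hu₃, hn₁, hn₂, hn₃, i12, i13, i23, -, -⟩ := exists_far_frame G hn hmenu
    have h1 := norm_eq_one_of_mem_fccSlots hu₁
    have h2 := norm_eq_one_of_mem_fccSlots hu₂
    have h3 := norm_eq_one_of_mem_fccSlots hu₃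
    have hsum := sum_eq_sqrt_six_smul (G u₁) (G u₂) (G u₃) n
      (by rw [LinearIsometryEquiv.norm_map, h1]) (by rw [LinearIsometryEquiv.norm_map, h2])
      (by rw [LinearIsometryEquiv.norm_map, h3]) hn
      (by rw [LinearIsometryEquiv.inner_map_map, i12]) (by rw [LinearIsometryEquiv.inner_map_map, i13])
      (by rw [LinearIsometryEquiv.inner_map_map, i23]) hn₁ hn₂ hn₃
    have hne : ⟪n, e₃⟫_ℝ = (⟪G u₁, e₃⟫_ℝ + ⟪G u₂, e₃⟫_ℝ + ⟪G u₃, e₃⟫_ℝ) / Real.sqrt 6 := by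
      have := congrArg (fun v => ⟪v, e₃⟫_ℝ) hsum
      simp only [inner_add_left, real_inner_smul_left] at this
      rw [this]; field_simp
    -- the three unit vectors `G uᵢ` as (mirrored) slots of `A₂`
    have key : ∃ w₁ ∈ fccSlots, ∃ w₂ ∈ fccSlots, ∃ w₃ ∈ fccSlots,
        ⟪n, e₃⟫_ℝ ^ 2 = (⟪A₂ w₁, e₃⟫_ℝ + ⟪A₂ w₂, e₃⟫_ℝ + ⟪A₂ w₃, e₃⟫_ℝ) ^ 2 / 6 := by
      have h66 : Real.sqrt 6 ^ 2 = 6 := Real.sq_sqrt (by norm_num)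
      have memG : ∀ {u}, u ∈ fccSlots → G u ∈ G '' fccStacking 1 (Real.sqrt (2 / 3)) :=
        fun hu => ⟨_, mem_fcc_of_mem_fccSlots hu, rfl⟩
      rcases hG with hEq | ⟨-, hEq⟩
      · have sl : ∀ {u}, u ∈ fccSlots → ∃ w ∈ fccSlots, A₂ w = G u := by
          intro u hu
          exact exists_slot_of_unit_mem A₂ (by rw [← hΛ₂, ← hEq]; exact memG hu)
            (by rw [LinearIsometryEquiv.norm_map, norm_eq_one_of_mem_fccSlots hu])
        obtain ⟨w₁, hw₁, e1⟩ := sl hu₁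
        obtain ⟨w₂, hw₂, e2⟩ := sl hu₂
        obtain ⟨w₃, hw₃, e3'⟩ := sl hu₃
        refine ⟨w₁, hw₁, w₂, hw₂, w₃, hw₃, ?_⟩
        rw [hne, e1, e2, e3', div_pow, h66]
      · have sl : ∀ {u}, u ∈ fccSlots → ∃ w ∈ fccSlots, H (A₂ w) = G u := by
          intro u hu
          have hGu : G u ∈ H '' Λ₂ := by rw [← hEq]; exact memG hu
          obtain ⟨v, hv, hvu⟩ := hGu
          have hv1 : ‖v‖ = 1 := by
            rw [← hHn v, hvu, LinearIsometryEquiv.norm_map, norm_eq_one_of_mem_fccSlots hu]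
          obtain ⟨w, hw, hwv⟩ := exists_slot_of_unit_mem A₂ hv hv1
          exact ⟨w, hw, by rw [hwv]; exact hvu⟩
        obtain ⟨w₁, hw₁, e1⟩ := sl hu₁
        obtain ⟨w₂, hw₂, e2⟩ := sl hu₂
        obtain ⟨w₃, hw₃, e3'⟩ := sl hu₃
        refine ⟨w₁, hw₁, w₂, hw₂, w₃, hw₃, ?_⟩
        rw [hne, ← e1, ← e2, ← e3', hHe, hHe, hHe, div_pow, h66]; ring
    obtain ⟨w₁, hw₁, w₂, hw₂, w₃, hw₃, hval⟩ := key
    have hmem : ⟪n, e₃⟫_ℝ ^ 2 ∈ BAD := by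
      rw [hBAD, mem_filter, hVALS, mem_image]
      exact ⟨⟨((w₁, w₂), w₃), by simp only [mem_product]; exact ⟨⟨hw₁, hw₂⟩, hw₃⟩, hval.symm⟩, hn2⟩
    exact hδ₀fac _ hmem

end Summit.Ventures.Crystal3D.Theorems

end
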